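import Summits.Langlands.Langlands.Theorems.SmithKummerSeedCyclicPrimeDescentWeakGalToAutIrreducible
import Summits.Langlands.Langlands.Theorems.SmithKummerSeedCyclicPrimeDescentWeakGalToAutReducible
import Summits.Langlands.Langlands.Theorems.SmithKummerSeedCyclicPrimeGlue
import HarnessLib

/-!
# The strategist's stub `stub_descentWeakGalToAut` of `CyclicPrimeDescent` (stmt-Langlands-18645) PROVED modulo six
# named facts; consequently `CyclicPrimeDescent` ⇐ `stub_descentAutToGal` + facts and the crux `AscentConjugationSolvable`
# (stmt-Langlands-1094) ⇐ three stubs + facts (lead c2 `--supports` helper)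

Support file (closes nothing).  The weak direction (B) of GL_n reciprocity DESCENDS along a Galois layer `L/K` of prime
degree, given reciprocity over `L` and direction (A) over `K` (same datum): by cases on the restriction `ρ|_{Γ_L}` of the
irreducible geometric `ρ : Γ_K → GL_n(ℚ̄_ℓ)` — irreducible (`weakGalToAut_descent_of_irreducible_restrictField`, p165721:
cyclic descent + prime twist matching) or reducible (`weakGalToAut_descent_of_reducible_restrictField`: Clifford ⇒
`ρ ≅ Ind s`, automorphic induction of `π_s`).  The six undischarged named facts of the tree enter as explicit hypotheses,
in this order: `cuspidal_descent_cyclic` (Arthur–Clozel Ch. 3 Thm. 4.2 (d)), `ArthurClozel1989_strongLifting_archimedean`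
(Thm. 5.1, archimedean clause), `AutomorphicRepData.exists_hasInfinityType` (Clozel; all `π`), `DeRhamBaseChange`
(Brinon–Conrad Prop. 6.3.8), `automorphicInduction_cyclic_cuspidal` (Arthur–Clozel Thm. 6.2),
`Henniart2012_infinityType_of_automorphicInduction` (Henniart 2012 Thm. 5).

* `descentWeakGalToAut_of_facts` — facts ⇒ VERBATIM the registered signature of `stub_descentWeakGalToAut`;
* `cyclicPrimeDescent_of_autToGal_of_facts` — facts ⇒ `stub_descentAutToGal` ⇒ `CyclicPrimeDescent` (glue
  `SmithKummerSeedCyclicPrimeGlue`, inlined composition);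
* `ascentConjugationSolvable_of_threeStubs_of_facts` — facts ⇒ `stub_ascentAutToGal` ⇒ `stub_ascentWeakGalToAut` ⇒
  `stub_descentAutToGal` ⇒ the crux (`SmithKummerSeed` spelling of the shared decl).

So, kernel-checked: modulo published theorems, the crux `AscentConjugationSolvable` is the conjunction of the UP-step's
two stubs (infrastructure-blocked: no `ReciprocityData L` is constructible, stmt-Langlands-17930) and `stub_descentAutToGal`
— whose R-free residue is the ATOM `InertTwistCoherenceAE` of `Cruxes/AscentConjugationSolvable/Atom.lean` (necessary:
Atom.lean; sufficient for weak (A)-descent in the cuspidal case: `descent_of_inertTwistCoherence`, p162893).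

References: Arthur–Clozel (1989) Ch. 3 Thms. 4.2, 5.1, 6.2; Henniart, Bull. SMF 140 (2012) Thm. 5; Clozel (1990) §3.3;
Brinon–Conrad (2009) Prop. 6.3.8; Barnet-Lamb–Gee–Geraghty–Taylor, Ann. of Math. 179 (2014) §5; Clifford (1937) Thm. 1.
-/

noncomputable section

set_option linter.dupNamespace false -- project-wide option; `Summit.Langlands.Langlands` is the mandated namespace

namespace Summit.Langlands.Langlands.Theorems.SmithKummerSeedCyclicPrimeDescent

open scoped MatrixGroups NumberField Classical Matrix
open Summit.Langlands Filter

/-- **Registered stub `descentWeakGalToAut_of_facts` (crux stmt-Langlands-1094, lead c2): the strategist's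
`stub_descentWeakGalToAut` (stmt-Langlands-18645) modulo six named facts** — by cases on the irreducibility of
`ρ|_{Γ_L}` (p165721 / the reducible companion). [cite: ArthurClozelAMS120, Ch. 3 Thms. 4.2 (d), 5.1 and 6.2]
[cite: Henniart2012, Thm. 5] [cite: BarnetlambEtAl2014, §5] -/
theorem descentWeakGalToAut_of_facts : Literature.NumberTheory.Automorphic.cuspidal_descent_cyclic → Literature.NumberTheory.Automorphic.ArthurClozel1989_strongLifting_archimedean → (∀ (n : ℕ) (K : Type) [Field K] [NumberField K] (hK : Literature.NumberTheory.Automorphic.isCompact_glFiniteIntegralLevel n K) (π : Literature.NumberTheory.Automorphic.AutomorphicRepData (Literature.NumberTheory.Automorphic.AutomorphyDatum.gl n K hK)), π.exists_hasInfinityType) → Literature.NumberTheory.PAdicHodge.DeRhamBaseChange → Literature.NumberTheory.Automorphic.automorphicInduction_cyclic_cuspidal → Literature.NumberTheory.Automorphic.Henniart2012_infinityType_of_automorphicInduction → ∀ (K L : Type) [Field K] [NumberField K] [Field L] [NumberField L] [Algebra K L] [IsGalois K L] (R : ReciprocityData K), (Module.finrank K L).Prime → (∃ R₁ : ReciprocityData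 L, ∀ n : ℕ, 0 < n → ∀ hcpt : Literature.NumberTheory.Automorphic.isCompact_glFiniteIntegralLevel n L, GlobalLanglandsCorrespondenceGLn n L R₁ hcpt) → (∀ n : ℕ, 0 < n → ∀ hcpt : Literature.NumberTheory.Automorphic.isCompact_glFiniteIntegralLevel n K, AutomorphicToGalois n R hcpt) → ∀ (n : ℕ), 0 < n → ∀ (ℓ : ℕ) [Fact ℓ.Prime] (ι : PadicAlgCl ℓ ≃+* ℂ) (ρ : Literature.NumberTheory.GaloisRepresentations.FramedGaloisRep K (PadicAlgCl ℓ) n), ρ.toGaloisRep.IsIrreducible → IsGeometricFramed R ρ → ∀ hcpt : Literature.NumberTheory.Automorphic.isCompact_glFiniteIntegralLevel n K, ∃ π : Literature.NumberTheory.Automorphic.CuspidalAutomorphicRepData n K hcpt, π.1.IsLAlgebraic ∧ ∀ᶠ v : IsDedekindDomain.HeightOneSpectrum (NumberField.RingOfIntegers K) in cofinite, SatakeFrobCompatibleAt ι π.1 ρ v := by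
  intro hdesc harch hinf hdR hAIf hHen K L _ _ _ _ _ _ R hp hRL hAK n hn ℓ _ ι ρ hirr hgeo hcpt
  by_cases h : (ρ.restrictField L).toGaloisRep.IsIrreducible
  · exact weakGalToAut_descent_of_irreducible_restrictField hdesc harch hinf hdR K L R hp hRL hAK n hn ℓ ι ρ hirr
      hgeo h hcpt
  · exact weakGalToAut_descent_of_reducible_restrictField hAIf hHen hinf hdR K L R hp hRL hAK n hn ℓ ι ρ hirr hgeo
      h hcpt

/-- **Registered stub `cyclicPrimeDescent_of_autToGal_of_facts` (lead c2): `CyclicPrimeDescent` (stmt-Langlands-18645) from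
`stub_descentAutToGal` ALONE, modulo the six named facts** (the (B)-stub being `descentWeakGalToAut_of_facts`; weak (B)
upgraded rank by rank by `SmithKummerSeedCyclicPrimeGlue.galoisToAutomorphic_of_weak_rank`).
[cite: ArthurClozelAMS120, Ch. 3 Thms. 4.2 and 6.2] -/
theorem cyclicPrimeDescent_of_autToGal_of_facts : Literature.NumberTheory.Automorphic.cuspidal_descent_cyclic → Literature.NumberTheory.Automorphic.ArthurClozel1989_strongLifting_archimedean → (∀ (n : ℕ) (K : Type) [Field K] [NumberField K] (hK : Literature.NumberTheory.Automorphic.isCompact_glFiniteIntegralLevel n K) (π : Literature.NumberTheory.Automorphic.AutomorphicRepData (Literature.NumberTheory.Automorphic.AutomorphyDatum.gl n K hK)), π.exists_hasInfinityType) → Literature.NumberTheory.PAdicHodge.DeRhamBaseChange → Literature.NumberTheory.Automorphic.automorphicInduction_cyclic_cuspidal → Literature.NumberTheory.Automorphic.Henniart2012_infinityType_of_automorphicInduction → (∀ (K L : Type) [Field K] [NumberField K] [Field L] [NumberField L] [Algebra K L] [IsGalois K L], (Module.finrank K L).Prime → (∃ R : ReciprocityData L, ∀ n : ℕ, 0 <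 n → ∀ hcpt : Literature.NumberTheory.Automorphic.isCompact_glFiniteIntegralLevel n L, GlobalLanglandsCorrespondenceGLn n L R hcpt) → ∃ R : ReciprocityData K, ∀ n : ℕ, 0 < n → ∀ hcpt : Literature.NumberTheory.Automorphic.isCompact_glFiniteIntegralLevel n K, AutomorphicToGalois n R hcpt) → Summit.Langlands.Langlands.Theses.SmithKummerSeed.CyclicPrimeDescent := by
  intro hdesc harch hinf hdR hAIf hHen h₁ K L _ _ _ _ _ _ hp hL
  obtain ⟨R, hAR⟩ := h₁ K L hp hL
  exact ⟨R, fun n hn hcpt => ⟨hAR n hn hcpt,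
    SmithKummerSeedCyclicPrimeGlue.galoisToAutomorphic_of_weak_rank R hAR hn hcpt fun ℓ _ ι ρ hi hg =>
      descentWeakGalToAut_of_facts hdesc harch hinf hdR hAIf hHen K L R hp hL hAR n hn ℓ ι ρ hi hg hcpt⟩⟩

/-- **Registered stub `ascentConjugationSolvable_of_threeStubs_of_facts` (lead c2): the crux `AscentConjugationSolvable`
(stmt-Langlands-1094; `SmithKummerSeed` spelling of the shared decl) from THREE stubs — the UP-step's `stub_ascentAutToGal`,
`stub_ascentWeakGalToAut` and the DOWN-step's `stub_descentAutToGal` — modulo the six named facts**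
(`SmithKummerSeedCyclicPrimeGlue.cyclicPrimeAscent_of_stubs`, `cyclicPrimeDescent_of_autToGal_of_facts`,
`AscentConjugationSolvableSplit.ascentConjugationSolvable_of_pieces`). [cite: ArthurClozelAMS120, Ch. 3 Thms. 4.2 and 6.2] -/
theorem ascentConjugationSolvable_of_threeStubs_of_facts : Literature.NumberTheory.Automorphic.cuspidal_descent_cyclic → Literature.NumberTheory.Automorphic.ArthurClozel1989_strongLifting_archimedean → (∀ (n : ℕ) (K : Type) [Field K] [NumberField K] (hK : Literature.NumberTheory.Automorphic.isCompact_glFiniteIntegralLevel n K) (π : Literature.NumberTheory.Automorphic.AutomorphicRepData (Literature.NumberTheory.Automorphic.AutomorphyDatum.gl n K hK)), π.exists_hasInfinityType) → Literature.NumberTheory.PAdicHodge.DeRhamBaseChange → Literature.NumberTheory.Automorphic.automorphicInduction_cyclic_cuspidal → Literature.NumberTheory.Automorphic.Henniart2012_infinityType_of_automorphicInduction → (∀ (K L : Type) [Field K] [NumberField K] [Field L] [NumberField L] [Algebra K L] [IsGalois K L], (Module.finrank K L).Prime → (∃ R : ReciprocityData K, ∀ n : ℕ, 0 < n → ∀ hcpt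 : Literature.NumberTheory.Automorphic.isCompact_glFiniteIntegralLevel n K, GlobalLanglandsCorrespondenceGLn n K R hcpt) → ∃ R : ReciprocityData L, ∀ n : ℕ, 0 < n → ∀ hcpt : Literature.NumberTheory.Automorphic.isCompact_glFiniteIntegralLevel n L, AutomorphicToGalois n R hcpt) → (∀ (K L : Type) [Field K] [NumberField K] [Field L] [NumberField L] [Algebra K L] [IsGalois K L] (R : ReciprocityData L), (Module.finrank K L).Prime → (∃ R₀ : ReciprocityData K, ∀ n : ℕ, 0 < n → ∀ hcpt : Literature.NumberTheory.Automorphic.isCompact_glFiniteIntegralLevel n K, GlobalLanglandsCorrespondenceGLn n K R₀ hcpt) → (∀ n : ℕ, 0 < n → ∀ hcpt : Literature.NumberTheory.Automorphic.isCompact_glFiniteIntegralLevel n L, AutomorphicToGalois n R hcpt) → ∀ (n : ℕ), 0 < n → ∀ (ℓ : ℕ) [Fact ℓ.Prime] (ι : PadicAlgCl ℓ ≃+* ℂ) (ρ : Literature.NumberTheory.GaloisRepresentations.FramedGaloisRep L (PadicAlgCl ℓ) n), ρ.toGaloisRep.IsIrreducible → IsGeometricFramed R ρ → ∀ hcpt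 : Literature.NumberTheory.Automorphic.isCompact_glFiniteIntegralLevel n L, ∃ π : Literature.NumberTheory.Automorphic.CuspidalAutomorphicRepData n L hcpt, π.1.IsLAlgebraic ∧ ∀ᶠ v : IsDedekindDomain.HeightOneSpectrum (NumberField.RingOfIntegers L) in cofinite, SatakeFrobCompatibleAt ι π.1 ρ v) → (∀ (K L : Type) [Field K] [NumberField K] [Field L] [NumberField L] [Algebra K L] [IsGalois K L], (Module.finrank K L).Prime → (∃ R : ReciprocityData L, ∀ n : ℕ, 0 < n → ∀ hcpt : Literature.NumberTheory.Automorphic.isCompact_glFiniteIntegralLevel n L, GlobalLanglandsCorrespondenceGLn n L R hcpt) → ∃ R : ReciprocityData K, ∀ n : ℕ, 0 < n → ∀ hcpt : Literature.NumberTheory.Automorphic.isCompact_glFiniteIntegralLevel n K, AutomorphicToGalois n R hcpt) → Summit.Langlands.Langlands.Theses.SmithKummerSeed.AscentConjugationSolvable :=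
  fun hdesc harch hinf hdR hAIf hHen hA₁ hA₂ hD₁ =>
    AscentConjugationSolvableSplit.ascentConjugationSolvable_of_pieces
      (SmithKummerSeedCyclicPrimeGlue.cyclicPrimeAscent_of_stubs hA₁ hA₂)
      (cyclicPrimeDescent_of_autToGal_of_facts hdesc harch hinf hdR hAIf hHen hD₁)

end Summit.Langlands.Langlands.Theorems.SmithKummerSeedCyclicPrimeDescent

end
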